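import Summits.BirchSwinnertonDyer.BirchSwinnertonDyer.Theorems.PrintCf2SplitBadTwoLayerShapiroUnramified
import Literature.NumberTheory.GaloisRepresentations.IntegralGaloisActionProofs
import Literature.NumberTheory.GaloisRepresentations.AbsGaloisOuterConj
import Literature.NumberTheory.GaloisRepresentations.DecompositionGroupOfCompletion
import Literature.NumberTheory.EllipticCurves.PeriodIndexCorestrictionLocal
import HarnessLib

/-!
# Route `ByReductionTypeAtTwo` (rung K4), crux `SupersingularRankZeroAtTwo` (item stmt-BirchSwinnertonDyer-19097), line
# `odd_blind_package` v2.18, stub `stub_flatPackage`, conjunct (8), clause F1♭ — dialect bridge for the levelwise supplier (S-LEV):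
# «every conjugate of a layer class is unramified at the chosen place above `u`» ⟹ «integral at `u`» (Kato's `res_{U ⊓ I_𝔓} = 0` for
# EVERY prime `𝔓 ∣ u`), and the RAMIFIED-SAFE Shapiro transport «`loc_u (Sh c)` unramified ⟹ `c` integral at `u`»
# (cell `bsd-2adic`, seat `bsd-2adic-t42` GEN 50, hand hF1♭-LEV, FILE 3a; `--supports 19097`, helper)

HONEST FRAMING (D-0054): THEOREMS ONLY — no definition, no named fact, no instance, no notation, no `sorry`.  Helper toward
conjunct (8); closes NO stub; 19097 stays OPEN on its 5 registered stubs (v2.18); BSD is proved for no curve by any of this.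
Generic number field `K`, normal subgroup `U ⊴ Γ_K`, discrete module `M`.

* `resLe_inertia_eq_zero_of_forall_conjH1_mem_unramifiedKer` — for `c ∈ H¹(U, M)` with `conj_σ c ∈ GreenbergVatsal2000.unramifiedKer U M u`
  for every `σ` (restriction to `U ⊓ I_u` vanishes, `I_u = I_{𝔓₀}` the inertia group of the prime of the chosen embedding), `res_{U ⊓ I_𝔓} c = 0`
  for every `𝔓 ∣ u`: `𝔓 = g𝔓₀` (`exists_smul_eq_of_mem_primesAbove_holds`), `I_𝔓 = g I_{𝔓₀} g⁻¹` (`Ideal.conj_mem_inertia_smul_iff`), and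
  `g⁻¹·ψ(g y g⁻¹) = (g⁻¹yg)·m − m` gives `ψ(y) = y·(gm) − gm`.
* `forall_primesAbove_resLe_eq_zero_of_localization_shapiroLift_mem` — with `PrintCf2.LayerShapiro.conjH1_mem_unramifiedKer_of_localization_shapiroLift_mem`
  (orbit detection, several `I(K_u)`-orbits allowed): `loc_u (Sh c) ∈ H¹_ur(K_u, Maps(Γ_K ⧸ U, M))` ⟹ `c` integral at `u`, with NO
  hypothesis that the coefficient module be unramified at `u` (the K2R0P♭ transport `resLe_inertia_eq_zero_of_localization_shapiroLift_mem`
  needs `IsUnramifiedAt`; the levelwise supplier needs the BAD places too).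

References: [NeukirchANT1999] Ch. I §9 Prop. (9.1), (9.4), Ch. II §9 Prop. (9.6); [NeukirchSchmidtWingberg2008] I §6 (1.6.4)–(1.6.5);
[MilneADT2006] I §2; [Kato2004Asterisque] §8.2 Lemma 8.5.
-/

set_option autoImplicit false
-- the Theorems namespace of this sub repeats the summit name by design (D-0017 nested layout)
set_option linter.dupNamespace false

noncomputable section

open scoped Classical NumberField

namespace Summit.BirchSwinnertonDyer.BirchSwinnertonDyer.Theorems

namespace SSFlatPT

open CategoryTheory Field NumberField IsDedekindDomain ContinuousCohomology
  Literature.NumberTheory.EllipticCurves Literature.NumberTheory.EllipticCurves.GreenbergSelmer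
  Literature.NumberTheory.GaloisRepresentations Literature.NumberTheory.GaloisRepresentations.DiscreteGaloisModule
  Summit.BirchSwinnertonDyer.Rank1Residual.X11b.LocBridge

/-! ## §1 «every conjugate unramified» ⟹ «integral» (Kato's currency), and the ramified-safe Shapiro transport -/

section Bridge

variable {K : Type} [Field K] [NumberField K]
  {M : Type} [AddCommGroup M] [DistribMulAction (absoluteGaloisGroup K) M] [TopologicalSpace M] [DiscreteTopology M]

/-- **«Every conjugate unramified at the chosen place above `u`» ⟹ «integral at `u`».**  For a normal subgroup `U ⊴ Γ_K`, a class
`c ∈ H¹(U, M)` all of whose conjugates `conj_σ c` restrict to zero on `U ⊓ I_u` (`GreenbergVatsal2000.unramifiedKer`, `I_u = I_{𝔓₀}` for the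
prime `𝔓₀` of the chosen embedding) restricts to zero on `U ⊓ I_𝔓` for EVERY prime `𝔓 ∣ u` of `ℤ̄_K`: `𝔓 = g𝔓₀` (transitivity,
`exists_smul_eq_of_mem_primesAbove_holds`), `I_𝔓 = g I_{𝔓₀} g⁻¹` (`Ideal.conj_mem_inertia_smul_iff`), and from `g⁻¹·ψ(g x g⁻¹) = x·m − m`
on `U ⊓ I_{𝔓₀}` one gets `ψ(y) = y·(g m) − g m` on `U ⊓ I_𝔓`. [cite: NeukirchANT1999, Ch. I §9 Prop. (9.1) and (9.4)]
[cite: Kato2004Asterisque, §8.2 Lemma 8.5 (pp. 183–184)] -/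
theorem resLe_inertia_eq_zero_of_forall_conjH1_mem_unramifiedKer (U : Subgroup (absoluteGaloisGroup K)) [U.Normal]
    (u : HeightOneSpectrum (𝓞 K)) (c : subgroupH1 U M)
    (h : ∀ σ : absoluteGaloisGroup K, conjH1 U M σ c ∈ GreenbergVatsal2000.unramifiedKer U M u) :
    ∀ 𝔓 ∈ u.primesAbove,
      resLe (discreteTopRep (absoluteGaloisGroup K) M) (inf_le_left : U ⊓ 𝔓.inertia (absoluteGaloisGroup K) ≤ U) 1 c = 0 := by
  intro 𝔓 h𝔓
  obtain ⟨g, hg⟩ := IsDedekindDomain.HeightOneSpectrum.exists_smul_eq_of_mem_primesAbove_holds (K := K) (v := u)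
    (adicCompletionPrime_mem_primesAbove K u) h𝔓
  obtain ⟨ψ, rfl⟩ := oneCocycleClass_surjective (discreteTopRep U M) c
  have hmem := h g⁻¹
  rw [Literature.NumberTheory.EllipticCurves.conjH1, resH1Hom_oneCocycleClass, PrintCf2.LayerShapiro.mem_unramifiedKer_iff_exists] at hmem
  obtain ⟨m, hm⟩ := hmem
  change resLe (discreteTopRep (absoluteGaloisGroup K) M) (inf_le_left : U ⊓ 𝔓.inertia (absoluteGaloisGroup K) ≤ U) 1
    (oneCocycleClass (subgroupRep (discreteTopRep (absoluteGaloisGroup K) M) U) ψ) = 0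
  rw [resLe_oneCocycleClass, oneCocycleClass_eq_zero_iff]
  refine ⟨g • m, fun y ↦ ?_⟩
  -- `x := g⁻¹ y g ∈ U ⊓ I_{𝔓₀}`
  have hyI : ((y : ↥(U ⊓ 𝔓.inertia (absoluteGaloisGroup K))) : absoluteGaloisGroup K) ∈ 𝔓.inertia (absoluteGaloisGroup K) := y.2.2
  have hxI : g⁻¹ * (y : absoluteGaloisGroup K) * g ∈ (adicCompletionPrime K u).inertia (absoluteGaloisGroup K) := by
    rw [← Ideal.conj_mem_inertia_smul_iff _ g, hg]
    simpa [mul_assoc] using hyI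
  have hxU : g⁻¹ * (y : absoluteGaloisGroup K) * g ∈ U := by
    simpa using Subgroup.Normal.conj_mem' inferInstance (y : absoluteGaloisGroup K) y.2.1 g
  have hxinert : g⁻¹ * (y : absoluteGaloisGroup K) * g ∈ inertia u := by
    change _ ∈ (absInertia (u.adicCompletion K)).map (absGaloisRestrict K (u.adicCompletion K)).toMonoidHom
    rw [← inertia_adicCompletionPrime_eq_map_absInertia]
    exact hxI
  have hxD : g⁻¹ * (y : absoluteGaloisGroup K) * g ∈ decomp (K := K) u := inertia_le_decomp u hxinert
  let x : inertiaIn U u := ⟨⟨_, hxD⟩, (mem_inertiaIn_iff U u _).2 ⟨hxU, hxinert⟩⟩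
  have key := hm x
  rw [pullback_resHomOfEquivariant_apply] at key
  -- the argument of `ψ` in `key` is `g x g⁻¹ = y`
  have harg : subgroupConj U g⁻¹ (inertiaInToH U u x) = subgroupInclusion (inf_le_left : U ⊓ 𝔓.inertia _ ≤ U) y := by
    apply Subtype.ext
    rw [subgroupConj_apply_coe, inv_inv, subgroupInclusion_apply_coe]
    change g * (g⁻¹ * (y : absoluteGaloisGroup K) * g) * g⁻¹ = y
    group
  rw [harg] at key
  -- `g⁻¹ • ψ y = x • m - m` ⟹ `ψ y = y • (g • m) - g • m`
  have hval : ψ.1 (subgroupInclusion (inf_le_left : U ⊓ 𝔓.inertia _ ≤ U) y) =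
      g • (((x : decomp (K := K) u) : absoluteGaloisGroup K) • m - m) := by
    rw [← key, DistribSMul.toAddMonoidHom_apply, smul_smul, mul_inv_cancel, one_smul]
  rw [contOneCocycles.pullback_apply, TopRep.hom_ofHom]
  change ψ.1 (subgroupInclusion (inf_le_left : U ⊓ 𝔓.inertia _ ≤ U) y) = (y : absoluteGaloisGroup K) • (g • m) - g • m
  rw [hval, smul_sub, smul_smul, smul_smul]
  change (g * (g⁻¹ * (y : absoluteGaloisGroup K) * g)) • m - g • m = _
  congr 2
  group

/-- **Ramified-safe Shapiro transport of «unramified» to «integral».**  For an open normal `U ⊴ Γ_K` of finite index with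
representatives `s`, a discrete `M` with open stabilisers and a layer class `c ∈ H¹(U, M)`: if `loc_u (Sh c)` lies in
`H¹_ur(K_u, Maps(Γ_K ⧸ U, M))`, then `res_{U ⊓ I_𝔓} c = 0` for every prime `𝔓 ∣ u` — NO hypothesis that the coefficient module be
unramified at `u` (`PrintCf2.LayerShapiro.conjH1_mem_unramifiedKer_of_localization_shapiroLift_mem`, several `I(K_u)`-orbits allowed, + §1).
[cite: NeukirchSchmidtWingberg2008, I §6 Prop. (1.6.4)–(1.6.5)] [cite: MilneADT2006, Ch. I §2] -/
theorem forall_primesAbove_resLe_eq_zero_of_localization_shapiroLift_mem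
    (hM : ∀ m : M, IsOpen {σ : absoluteGaloisGroup K | σ • m = m}) (U : Subgroup (absoluteGaloisGroup K)) [U.Normal]
    (hU : IsOpen (U : Set (absoluteGaloisGroup K))) [Fintype (absoluteGaloisGroup K ⧸ U)]
    {s : absoluteGaloisGroup K ⧸ U → absoluteGaloisGroup K} (hs : ∀ y, (s y : absoluteGaloisGroup K ⧸ U) = y)
    (hs1 : s ((1 : absoluteGaloisGroup K) : absoluteGaloisGroup K ⧸ U) = 1) (u : HeightOneSpectrum (𝓞 K)) (c : subgroupH1 U M)
    (hc : galoisCohomology.localization ((ofSMul M hM).coind U hU) (Sum.inr u) 1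
        (shapiroLift (ofSMul M hM).toTopRep U hU hs hs1 c) ∈
      DiscreteGaloisModule.unramifiedSubgroup (GaloisRep.toLocal u ((ofSMul M hM).coind U hU)) 1) :
    ∀ 𝔓 ∈ u.primesAbove,
      resLe (discreteTopRep (absoluteGaloisGroup K) M) (inf_le_left : U ⊓ 𝔓.inertia (absoluteGaloisGroup K) ≤ U) 1 c = 0 :=
  resLe_inertia_eq_zero_of_forall_conjH1_mem_unramifiedKer U u c
    (PrintCf2.LayerShapiro.conjH1_mem_unramifiedKer_of_localization_shapiroLift_mem hM U hU hs hs1 u c hc)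

end Bridge

end SSFlatPT

end Summit.BirchSwinnertonDyer.BirchSwinnertonDyer.Theorems

end
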